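import Literature.NumberTheory.EllipticCurves.LocalUnramifiedCocycleTorsion
import Literature.NumberTheory.EllipticCurves.SelmerLocalConditionGoodReductionAnyProofs
import Literature.NumberTheory.EllipticCurves.KodairaNeronUnramifiedInertiaProofs
import Literature.NumberTheory.EllipticCurves.StrictSelmerRankOne
import HarnessLib

/-!
# Unramified classes satisfy the local Selmer condition UP TO A BOUNDED EXPONENT at EVERY finite
# place (bad places included): `#E(K_v)[n] · c ∈ 𝓢_v(E)` for `c ∈ H¹(K, E[n])` unramified at a
# prime above `v`

`Proofs`-style file (theorems only: no definition, no named fact, no `sorry`) in topic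
`NumberTheory/EllipticCurves`, companion of `SelmerLocalConditionGoodReductionAnyProofs.lean` (which
proves, at a place `v` of GOOD reduction, `unramifiedKer (E[n]) 𝔓 ≤ selmerLocalKer W K_v n`, Milne
*ADT* I.3.8).  At a place of BAD reduction an unramified class need not satisfy the Kummer condition,
but it does after multiplication by the integer `#E(K_v)[n]` — indeed its restriction to `Γ_{K_v}`
then vanishes in `H¹(K_v, E[n])` already: an unramified local class lives in
`H¹(K_v^nr/K_v, E[n]^{I_v}) ≅ E[n]^{I_v}/(Frob − 1)`, a group of order `#E[n](K_v)` (the tree's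
`card_fixedPoints_nsmul_eq_zero_of_mem_subgroupResKer_absInertia`, file
`LocalUnramifiedCocycleTorsion.lean`).  For `n = p^k` the exponent `#E(K_v)[p^k]` divides
`#E(K_v)[p^∞]`, which does not depend on `k`: this is the UNIFORM bound a `T_p`-adic argument needs at
the finitely many bad places `v ∤ p` (cell `bsd-cn100`, seat `bsd-cn100-transfer-2` g6, brick (L2b)
of the discharge of `Kato2004.locP_kernel_isTorsion_of_rankOne`, assembly by seat `bsd-cn100-s2-c3`;
nothing about BSD is claimed here).

## Results (for `E = W` elliptic over a number field `K`, `v` ANY finite place, `n ≠ 0`)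

* `WeierstrassCurve.nsmul_mem_selmerLocalKerOfEmb_of_mem_unramifiedKer` — embedding form with the
  sharp bound: for `ι : K̄ → K̄_v`, `𝔐` a local prime and `𝔓 = 𝔓_{ι,𝔐}`, every `c ∈ H¹(K, E[n])`
  unramified at `𝔓` has `B • c ∈ selmerLocalKerOfEmb W K_v ι n` with
  `B = #{P ∈ E[n] | Γ_{K_v} fixes P through ι}`.
* `WeierstrassCurve.card_fixed_dvd_card_torsionPoints` — that `B` divides `#E(K_v)[n]` (Galois
  descent `E(K̄_v)^{Γ_{K_v}} = E(K_v)`, `exists_map_eq_of_forall_smul_localPoints_eq`).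
* `WeierstrassCurve.card_torsionPoints_nsmul_mem_selmerLocalKer_of_mem_unramifiedKer` — for every
  prime `𝔓` above `v`: `#E(K_v)[n] • c ∈ selmerLocalKer W K_v n` for `c` unramified at `𝔓`.
* `WeierstrassCurve.card_primaryComponent_nsmul_mem_selmerLocalKer_of_mem_unramifiedKer` — the
  `p`-primary uniform form: if `E(K_v)[p^∞]` is finite then for EVERY `k`,
  `#E(K_v)[p^∞] • c ∈ selmerLocalKer W K_v (p^k)` for `c ∈ H¹(K, E[p^k])` unramified at `𝔓`.

## References

* [MilneADT2006] J. S. Milne, *Arithmetic Duality Theorems* (2006), Ch. I §2 Lemma 2.10 and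
  Prop. 3.8 (unramified cohomology).
* [SerreLocalFields1979] J.-P. Serre, *Local Fields*, XIII §1, XIII §4.
* [NeukirchANT1999] J. Neukirch, *Algebraic Number Theory*, Ch. II §9 (9.3), (9.6).
* [SilvermanAEC2009] J. H. Silverman, *AEC*, VII.§4, VIII.§2, X.§4.
-/

noncomputable section

open scoped Classical Pointwise
open NumberField IsDedekindDomain Field
open Literature.NumberTheory.EllipticCurves Literature.NumberTheory.GaloisRepresentations

universe u

namespace WeierstrassCurve

variable {K : Type u} [Field K] [NumberField K] (W : WeierstrassCurve K) [W.IsElliptic]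

/-! ## §1 The embedding form with the sharp bound -/

/-- **Unramified ⟹ local Selmer condition up to the exponent `#E[n]^{Γ_{K_v}}`, at ANY place.** Let
`v` be a finite place, `n ≠ 0`, `ι : K̄ → K̄_v` a `K`-embedding, `𝔐` a prime of `\bar 𝓞_v` above
`𝓂_v`, `𝔓 = 𝔓_{ι,𝔐}`, and `c ∈ H¹(K, E[n])` unramified at `𝔓`.  With
`B = #{P ∈ E[n] | res_ι(σ) • P = P for all σ ∈ Γ_{K_v}}`, the class `B • c` dies in `H¹(K_v, E)`
along `ι` (`selmerLocalKerOfEmb`).  Proof: a cocycle `φ` of `c` has `φ|_{I_𝔓} = ∂a`; the pulled-back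
cocycle `σ ↦ φ(res_ι σ)` on `Γ_{K_v}` (coefficients `E[n]` with `Γ_{K_v}` acting through `res_ι`)
restricts to `∂a` on the local inertia group `I_𝔐 = I_{K_v}` (`resGalOfEmb_mem_inertia_primeBelow`,
`inertia_eq_absInertia`), so `B •` its class vanishes
(`card_fixedPoints_nsmul_eq_zero_of_mem_subgroupResKer_absInertia`): `B • φ(res_ι σ) = res_ι σ • m − m`
for some `m ∈ E[n]`; pushing along `ι_* : E(K̄) → E(K̄_v)` the local cocycle of `B • c` is the
coboundary of `ι_* m`. [cite: MilneADT2006, Ch. I §2 Lemma 2.10] [cite: NeukirchANT1999, Ch. II §9 (9.3)] -/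
theorem nsmul_mem_selmerLocalKerOfEmb_of_mem_unramifiedKer (v : HeightOneSpectrum (𝓞 K)) {n : ℤ}
    (hn : n ≠ 0) (ι : AlgebraicClosure K →ₐ[K] AlgebraicClosure (v.adicCompletion K))
    {𝔐 : Ideal v.localAbsIntegers} (h𝔐 : 𝔐 ∈ v.localPrimesAbove) {c : galH1Torsion W n}
    (hc : c ∈ unramifiedKer (geomTorsion W n) (v.primeBelow ι 𝔐)) :
    Nat.card {P : geomTorsion W n //
        ∀ σ : absoluteGaloisGroup (v.adicCompletion K), resGalOfEmb ι σ • P = P} • c ∈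
      selmerLocalKerOfEmb W (v.adicCompletion K) ι n := by
  -- `Γ_{K_v}` acting on `E[n]` through `ι`
  letI instv : DistribMulAction (absoluteGaloisGroup (v.adicCompletion K)) (geomTorsion W n) :=
    DistribMulAction.compHom _ ((resGalOfEmb ι : absoluteGaloisGroup (v.adicCompletion K) →ₜ*
      absoluteGaloisGroup K) : absoluteGaloisGroup (v.adicCompletion K) →* absoluteGaloisGroup K)
  have hsmul : ∀ (σ : absoluteGaloisGroup (v.adicCompletion K)) (P : geomTorsion W n),
      σ • P = resGalOfEmb ι σ • P := fun _ _ => rfl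
  haveI : ContinuousSMul (absoluteGaloisGroup K) (geomTorsion W n) :=
    W.continuousSMul_geomTorsion (isOpen_stabilizer_point_holds W) n
  haveI : ContinuousSMul (absoluteGaloisGroup (v.adicCompletion K)) (geomTorsion W n) := by
    rw [continuousSMul_iff_stabilizer_isOpen]
    intro P
    have hK : IsOpen (MulAction.stabilizer (absoluteGaloisGroup K) P : Set (absoluteGaloisGroup K)) :=
      stabilizer_isOpen (absoluteGaloisGroup K) P
    have heq : (MulAction.stabilizer (absoluteGaloisGroup (v.adicCompletion K)) P :
        Set (absoluteGaloisGroup (v.adicCompletion K))) =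
        resGalOfEmb ι ⁻¹' (MulAction.stabilizer (absoluteGaloisGroup K) P : Set (absoluteGaloisGroup K)) := by
      ext σ
      simp only [SetLike.mem_coe, MulAction.mem_stabilizer_iff, Set.mem_preimage, hsmul]
    rw [heq]
    exact hK.preimage (resGalOfEmb ι).continuous
  haveI : Finite (geomTorsion W n) := W.finite_torsionPoints_holds (AlgebraicClosure K) hn
  obtain ⟨φ, rfl⟩ :=
    oneCocycleClass_surjective (discreteTopRep (absoluteGaloisGroup K) (geomTorsion W n)) c
  -- `φ|_{I_𝔓} = ∂a`
  obtain ⟨a, ha⟩ := (oneCocycleClass_mem_subgroupResKer_iff _ φ).mp hc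
  -- the pulled-back cocycle on `Γ_{K_v}` with coefficients `E[n]`
  set g₀ := contOneCocycles.pullback (resGalOfEmb ι)
    (X := discreteTopRep (absoluteGaloisGroup K) (geomTorsion W n))
    (Y := discreteTopRep (absoluteGaloisGroup (v.adicCompletion K)) (geomTorsion W n))
    (resHomOfEquivariant (resGalOfEmb ι) (AddMonoidHom.id (geomTorsion W n)) fun σ P ↦ rfl) φ
    with hg₀
  have hg₀_apply : ∀ σ, g₀.1 σ = φ.1 (resGalOfEmb ι σ) := fun σ => by
    rw [hg₀, contOneCocycles.pullback_apply]; rfl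
  -- it restricts to the coboundary `∂a` on the local inertia group `I_{K_v} = I_𝔐 → I_𝔓`
  obtain ⟨w, hw⟩ := v.exists_spectralValuation
  have hI : oneCocycleClass _ g₀ ∈
      subgroupResKer (geomTorsion W n) (absInertia (v.adicCompletion K)) := by
    rw [oneCocycleClass_mem_subgroupResKer_iff]
    refine ⟨a, fun σ => ?_⟩
    have hσ : (σ : absoluteGaloisGroup (v.adicCompletion K)) ∈
        𝔐.inertia (absoluteGaloisGroup (v.adicCompletion K)) := by
      rw [HeightOneSpectrum.inertia_eq_absInertia hw h𝔐]; exact σ.2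
    rw [hg₀_apply]
    exact ha ⟨_, v.resGalOfEmb_mem_inertia_primeBelow ι 𝔐 hσ⟩
  -- the local exponent kills its class
  have hkill := card_fixedPoints_nsmul_eq_zero_of_mem_subgroupResKer_absInertia hI
  have hB : Nat.card (MulAction.fixedPoints (absoluteGaloisGroup (v.adicCompletion K)) (geomTorsion W n)) =
      Nat.card {P : geomTorsion W n //
        ∀ σ : absoluteGaloisGroup (v.adicCompletion K), resGalOfEmb ι σ • P = P} :=
    Nat.card_congr (Equiv.subtypeEquivRight fun P => Iff.rfl)
  rw [hB] at hkill
  set B := Nat.card {P : geomTorsion W n //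
    ∀ σ : absoluteGaloisGroup (v.adicCompletion K), resGalOfEmb ι σ • P = P} with hBdef
  -- a witness `m`: `B • φ(res σ) = res σ • m − m`
  have h0 : oneCocycleClass _ ((B : ℤ) • g₀) = 0 := by
    rw [oneCocycleClass_smul, Nat.cast_smul_eq_nsmul]; exact hkill
  obtain ⟨m, hm⟩ := (oneCocycleClass_eq_zero_iff _ _).mp h0
  have hm' : ∀ σ : absoluteGaloisGroup (v.adicCompletion K),
      (B : ℤ) • φ.1 (resGalOfEmb ι σ) = resGalOfEmb ι σ • m - m := fun σ => by
    have h := hm σ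
    rw [← hg₀_apply]
    exact h
  -- conclusion: along `ι_*` the local cocycle of `B • [φ]` is the coboundary of `ι_* m`
  unfold selmerLocalKerOfEmb
  rw [← Nat.cast_smul_eq_nsmul ℤ B, ← oneCocycleClass_smul, mem_resKer_iff, map_oneCocycleClass,
    oneCocycleClass_eq_zero_iff]
  refine ⟨pointsMapOfEmb W ι (m : geomPoints W), fun σ => ?_⟩
  rw [contOneCocycles.pullback_apply]
  change pointsMapOfEmb W ι ((((B : ℤ) • φ).1 (resGalOfEmb ι σ) : geomTorsion W n) : geomPoints W) =
    σ • pointsMapOfEmb W ι (m : geomPoints W) - pointsMapOfEmb W ι (m : geomPoints W)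
  have hval : ((B : ℤ) • φ).1 (resGalOfEmb ι σ) = (B : ℤ) • φ.1 (resGalOfEmb ι σ) := rfl
  rw [hval, hm', AddSubgroupClass.coe_sub, map_sub,
    Literature.NumberTheory.EllipticCurves.AddSubgroup.torsionBy.coe_smul, pointsMapOfEmb_smul W ι σ]

/-! ## §2 The bound divides `#E(K_v)[n]` -/

omit [W.IsElliptic] in
/-- **`#E[n]^{Γ_{K_v}} ∣ #E(K_v)[n]`**: the points of `E[n] ⊆ E(K̄)` fixed by `Γ_{K_v}` (acting
through `ι`) inject, `ι`-equivariantly, into the `Γ_{K_v}`-fixed points of `E(K̄_v)`, which come from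
`E(K_v)` by Galois descent (`exists_map_eq_of_forall_smul_localPoints_eq`); `n`-torsion is preserved
so the cardinality divides (`AddSubgroup.card_dvd_of_injective`; both sides are finite for `n ≠ 0`,
AEC III.6.4, though the divisibility needs no finiteness). [cite: SilvermanAEC2009, Cor. III.6.4 and VIII.§1] -/
theorem card_fixed_dvd_card_torsionPoints (v : HeightOneSpectrum (𝓞 K)) (n : ℤ)
    (ι : AlgebraicClosure K →ₐ[K] AlgebraicClosure (v.adicCompletion K)) :
    Nat.card {P : geomTorsion W n //
        ∀ σ : absoluteGaloisGroup (v.adicCompletion K), resGalOfEmb ι σ • P = P} ∣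
      Nat.card (torsionPoints W (v.adicCompletion K) n) := by
  haveI : CharZero (v.adicCompletion K) :=
    charZero_of_injective_algebraMap (algebraMap K (v.adicCompletion K)).injective
  haveI : PerfectField (v.adicCompletion K) := PerfectField.ofCharZero
  -- the fixed points as a subgroup of `E[n]`
  let Fx : AddSubgroup (geomTorsion W n) :=
    { carrier := {P | ∀ σ : absoluteGaloisGroup (v.adicCompletion K), resGalOfEmb ι σ • P = P}
      zero_mem' := fun σ => smul_zero _
      add_mem' := fun {a b} ha hb σ => by rw [smul_add, ha σ, hb σ]
      neg_mem' := fun {a} ha σ => by rw [smul_neg, ha σ] }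
  have hcard : Nat.card {P : geomTorsion W n //
      ∀ σ : absoluteGaloisGroup (v.adicCompletion K), resGalOfEmb ι σ • P = P} = Nat.card Fx :=
    Nat.card_congr (Equiv.subtypeEquivRight fun P => Iff.rfl)
  rw [hcard]
  -- the base-change map `E(K_v) → E(K̄_v)` (injective) and descent of `ι_* P` for `P ∈ Fx`
  set j : (W.baseChange (v.adicCompletion K)).toAffine.Point →+ localPoints W (v.adicCompletion K) :=
    Affine.Point.map (IsScalarTower.toAlgHom K (v.adicCompletion K)
      (AlgebraicClosure (v.adicCompletion K))) with hj
  have hjinj : Function.Injective j := by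
    rw [hj]; exact Affine.Point.map_injective _
  have hdesc : ∀ P : Fx, ∃ R : (W.baseChange (v.adicCompletion K)).toAffine.Point,
      j R = pointsMapOfEmb W ι ((P : geomTorsion W n) : geomPoints W) := fun P => by
    refine exists_map_eq_of_forall_smul_localPoints_eq W (v.adicCompletion K) fun τ => ?_
    rw [← pointsMapOfEmb_smul W ι τ]
    congr 1
    have h := P.2 τ
    exact congrArg (fun Q : geomTorsion W n => (Q : geomPoints W)) h
  choose R hR using hdesc
  -- `R` is an injective additive map into `E(K_v)[n]`
  have hRn : ∀ P : Fx, R P ∈ torsionPoints W (v.adicCompletion K) n := fun P => by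
    refine (Submodule.mem_torsionBy_iff _ _).mpr (hjinj ?_)
    rw [map_zsmul, hR, map_zero, ← map_zsmul]
    have hP : n • (((P : geomTorsion W n) : geomPoints W)) = 0 :=
      (Submodule.mem_torsionBy_iff _ _).mp (P : geomTorsion W n).2
    rw [hP, map_zero]
  let f : Fx →+ torsionPoints W (v.adicCompletion K) n :=
    { toFun := fun P => ⟨R P, hRn P⟩
      map_zero' := Subtype.ext (hjinj (by
        rw [hR]
        change j 0 = pointsMapOfEmb W ι ((0 : geomTorsion W n) : geomPoints W)
        rw [map_zero, ZeroMemClass.coe_zero, map_zero]))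
      map_add' := fun P Q => Subtype.ext (hjinj (by
        change j (R (P + Q)) = j (R P + R Q)
        rw [map_add, hR, hR, hR]
        change pointsMapOfEmb W ι (((P : geomTorsion W n) + (Q : geomTorsion W n) : geomTorsion W n) :
          geomPoints W) = _
        rw [AddSubgroup.coe_add, map_add])) }
  have hf : Function.Injective f := fun P Q hPQ => by
    have h1 : R P = R Q := congrArg Subtype.val hPQ
    have h2 := congrArg j h1
    rw [hR, hR] at h2
    exact Subtype.ext (Subtype.ext (pointsMapOfEmb_injective W ι h2))
  exact AddSubgroup.card_dvd_of_injective f hf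

/-- **Embedding form with the bound `#E(K_v)[n]`**: for `c ∈ H¹(K, E[n])` unramified at
`𝔓_{ι,𝔐}`, `#E(K_v)[n] • c ∈ selmerLocalKerOfEmb W K_v ι n`.
[cite: MilneADT2006, Ch. I §2 Lemma 2.10] [cite: SilvermanAEC2009, Cor. III.6.4] -/
theorem card_torsionPoints_nsmul_mem_selmerLocalKerOfEmb_of_mem_unramifiedKer
    (v : HeightOneSpectrum (𝓞 K)) {n : ℤ} (hn : n ≠ 0)
    (ι : AlgebraicClosure K →ₐ[K] AlgebraicClosure (v.adicCompletion K))
    {𝔐 : Ideal v.localAbsIntegers} (h𝔐 : 𝔐 ∈ v.localPrimesAbove) {c : galH1Torsion W n}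
    (hc : c ∈ unramifiedKer (geomTorsion W n) (v.primeBelow ι 𝔐)) :
    Nat.card (torsionPoints W (v.adicCompletion K) n) • c ∈
      selmerLocalKerOfEmb W (v.adicCompletion K) ι n := by
  obtain ⟨d, hd⟩ := W.card_fixed_dvd_card_torsionPoints v n ι
  rw [hd, mul_nsmul]
  exact AddSubgroup.nsmul_mem _ (W.nsmul_mem_selmerLocalKerOfEmb_of_mem_unramifiedKer v hn ι h𝔐 hc) d

/-! ## §3 Any prime above `v`, embedding-free local condition -/

/-- **Unramified ⟹ `#E(K_v)[n]` times the class satisfies the local Selmer condition, at ANY finite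
place** (bad places included).  For a finite place `v`, `n ≠ 0`, a prime `𝔓` of `\bar ℤ_K` above `v`
and `c ∈ H¹(K, E[n])` unramified at `𝔓`: `#E(K_v)[n] • c ∈ selmerLocalKer W K_v n`.  Reduction to
the embedding form exactly as in `unramifiedKer_le_selmerLocalKer_of_hasGoodReductionAt`: `Γ_K` is
transitive on the primes above `v` (`exists_smul_eq_of_mem_primesAbove_holds`) and the local kernel
does not depend on the embedding (`selmerLocalKer_eq_of_algHom_holds`).  At a place of good
reduction the factor is not needed (Milne I.3.8, the companion file).
[cite: MilneADT2006, Ch. I §2 Lemma 2.10 and Prop. 3.8] [cite: NeukirchANT1999, Ch. II §9 Prop. (9.6)] -/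
theorem card_torsionPoints_nsmul_mem_selmerLocalKer_of_mem_unramifiedKer
    {v : HeightOneSpectrum (𝓞 K)} {n : ℤ} (hn : n ≠ 0)
    {𝔓 : Ideal (absIntegers (𝓞 K) K)} (h𝔓 : 𝔓 ∈ v.primesAbove) {c : galH1Torsion W n}
    (hc : c ∈ unramifiedKer (geomTorsion W n) 𝔓) :
    Nat.card (torsionPoints W (v.adicCompletion K) n) • c ∈ selmerLocalKer W (v.adicCompletion K) n := by
  obtain ⟨𝔐, h𝔐⟩ := v.localPrimesAbove_nonempty
  obtain ⟨g, hg⟩ := HeightOneSpectrum.exists_smul_eq_of_mem_primesAbove_holds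
    (HeightOneSpectrum.primeBelow_mem_primesAbove
      (ι := closureEmb (K := K) (v.adicCompletion K)) h𝔐) h𝔓
  have h1 : 𝔓 = v.primeBelow ((closureEmb (K := K) (v.adicCompletion K)).comp
      ((show AlgebraicClosure K ≃ₐ[K] AlgebraicClosure K from g⁻¹) :
        AlgebraicClosure K →ₐ[K] AlgebraicClosure K)) 𝔐 := by
    rw [HeightOneSpectrum.primeBelow_comp, ← hg]
    exact congrArg (· • _) (inv_inv g).symm
  rw [← selmerLocalKer_eq_of_algHom_holds W (v.adicCompletion K)
    ((closureEmb (K := K) (v.adicCompletion K)).comp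
      ((show AlgebraicClosure K ≃ₐ[K] AlgebraicClosure K from g⁻¹) :
        AlgebraicClosure K →ₐ[K] AlgebraicClosure K)) n]
  rw [h1] at hc
  exact W.card_torsionPoints_nsmul_mem_selmerLocalKerOfEmb_of_mem_unramifiedKer v hn _ h𝔐 hc

/-! ## §4 The `p`-primary form, uniform in the level `p^k` -/

/-- **Uniform `p`-primary form.**  If the `p`-primary torsion `E(K_v)[p^∞]` of `E(K_v)` is finite
(always true; e.g. over `ℚ_ℓ` from `E(ℚ_ℓ) ⊇ ℤ_ℓ` of finite index, AEC VII.6.3), then for EVERY `k`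
and every `c ∈ H¹(K, E[p^k])` unramified at a prime `𝔓` above `v`:
`#E(K_v)[p^∞] • c ∈ selmerLocalKer W K_v (p^k)` — an exponent independent of `k`
(`#E(K_v)[p^k] ∣ #E(K_v)[p^∞]`). [cite: MilneADT2006, Ch. I §2 Lemma 2.10] [cite: SilvermanAEC2009, Prop. VII.6.3] -/
theorem card_primaryComponent_nsmul_mem_selmerLocalKer_of_mem_unramifiedKer
    {v : HeightOneSpectrum (𝓞 K)} (p : ℕ) [Fact p.Prime]
    [Finite (AddCommGroup.primaryComponent (W.baseChange (v.adicCompletion K)).toAffine.Point p)]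
    (k : ℕ) {𝔓 : Ideal (absIntegers (𝓞 K) K)} (h𝔓 : 𝔓 ∈ v.primesAbove)
    {c : galH1Torsion W ((p : ℤ) ^ k)} (hc : c ∈ unramifiedKer (geomTorsion W ((p : ℤ) ^ k)) 𝔓) :
    Nat.card (AddCommGroup.primaryComponent (W.baseChange (v.adicCompletion K)).toAffine.Point p) • c ∈
      selmerLocalKer W (v.adicCompletion K) ((p : ℤ) ^ k) := by
  have hp : p.Prime := Fact.out
  have hn : ((p : ℤ) ^ k) ≠ 0 := pow_ne_zero k (Int.natCast_ne_zero.mpr hp.ne_zero)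
  -- `E(K_v)[p^k] ≤ E(K_v)[p^∞]`
  have hle : torsionPoints W (v.adicCompletion K) ((p : ℤ) ^ k) ≤
      AddCommGroup.primaryComponent (W.baseChange (v.adicCompletion K)).toAffine.Point p := by
    intro P hP
    have hP' : ((p : ℤ) ^ k) • P = 0 := (Submodule.mem_torsionBy_iff _ _).mp hP
    refine (AddCommGroup.mem_primaryComponent).mpr ⟨k, ?_⟩
    rw [← natCast_zsmul]
    push_cast
    exact hP'
  obtain ⟨d, hd⟩ := AddSubgroup.card_dvd_of_le hle
  rw [hd, mul_nsmul]
  exact AddSubgroup.nsmul_mem _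
    (W.card_torsionPoints_nsmul_mem_selmerLocalKer_of_mem_unramifiedKer hn h𝔓 hc) d

end WeierstrassCurve

end
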